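import Summits.QuantumFields.BalabanUV.Beta.GAN24.SlotTransportPeriodicWeight
import Summits.QuantumFields.BalabanUV.Beta.GAN24.CoarseGaugeSourceResponse

/-!
# `BalabanUV.Beta.GAN24.ClassWeightSlotTransport` — binder row G-an2-4 ∕ (CONV-C), TRANSFER-III, the (III′) (C)-campaign's supplier `hB0` AT LEVELS `≥ 1`,
# the STRUCTURAL LETTER behind the (D)_comb tower (leaf-01 g86 «LOCATED» L-leaf01-g86-1, RESOLVED BY NAME): **A SINGLE-COORDINATE-WEIGHTED SLOT SUM SEES THE
# SLOT TRANSPORT `Ψ_Sᵀ` AS A SINGLE-COORDINATE REWEIGHTING OF THE SAME DIRECTION** — for every bond family `T` with summable components, every bounded `s : ℤ → ℝ`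
# and every slot direction `α`:
#   `Σ'_x s(x_α) · slotPsiS r n T α x = Σ'_x (s(x_α) + (G((x_α + 1) ∕ n) − G(x_α ∕ n))) · T α x`,  `G(m) := Σ_{b ∈ box} s(n·m + b_α) · faceWt r n α b`
# (integer division); so the hereditary class «constant + lattice gradient of a bounded single-coordinate function» of leaf-04's (D)-tower
# (`ExitFaceCurrentTowerStep`) is STABLE under `slotPsiS` — and hence (leaf-03's `SymCorrectorSlot.comp_psiKS_inl_right ∕ comp_trK_psiKS_inl_left`: both corrector legs of
# `𝒯S = Ψ̂_Sᵀ ∘ slotPsiS S ∘ Ψ̂_S` ARE slot transports of the row ∕ column families) under the whole transport `𝒯` (next file `TransportedDivFree`).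
# (G-an2-4 CRUX TEAM (2), leaf prover `b2b-balaban-gan24-formalise-leaf-01`, gen 87)

WHY THIS IS NOT g86's «Ward letters» (README-g86 L-leaf01-g86-1).  The face part of the slot transport against a weight `ω` is `Σ_Y c_ω(Y) • faceSum n T Y` with
`c_ω(Y) = Σ_{x ∈ B(Y)} ω(x)·faceWt α x`, and `faceSum n T Y` is the block total of the divergence of `T` (TT7), so by parts it is `Σ_κ Σ'_x (c_ω(blk(x+e_κ)) − c_ω(blk x))·T κ x`
— the response to the block-constant pure gauge `d(c_ω ∘ blk)`, in ALL directions `κ` for a general `ω`.  BUT for a SINGLE-COORDINATE weight `ω(x) = s(x_α)` in the slot's own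
direction the block function `c_ω(Y) = G(Y_α)` depends on the `α`-th block coordinate ONLY (block covariance of `faceWt`), and `blk(x + e_κ)` differs from `blk x` in the `κ`-th
coordinate only: the pure gauge lives on the `α`-bonds, `d(c_ω ∘ blk)(κ, x) = [κ = α]·(G((x_α+1)∕n) − G(x_α∕n))`.  No Ward identity of `T` is used.  The periodic case of leaf-01 g85 F7
`SlotTransportPeriodicWeight.tsum_weight_mul_slotPsiS` is the sub-case `G` constant.

NOT IN PRINT; OUR BOOKKEEPING ([folklore] lattice-sum bookkeeping BY NAME over d1-leaf-03's typed objects `SymCorrectorFace.faceWt ∕ faceSum ∕ slotPsiS`, leaf-01 g84∕g85's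
`SymCorrectorZeroMode` (`faceSum_eq_sum_box_div`, `summable_faceSum`, `faceWt_block`, `summable_div`) and `SlotTransportPeriodicWeight` (summabilities), road-P2 g41's
summation by parts `CoarseGaugeSourceResponse.tsum_mul_coarseDiv_eq`, lit-balaban's `KKTFluctuationEnergy.tsum_blocks`; generic dimension `d+1`, block side `0 < n`, ANY root
offset `r`; 0 `def`, 0 cited fact, 0 `def … : Prop`, 0 sorry).
HONEST FRAMING (cell contract, verbatim): «discharging `BetaPertH` makes Bałaban's UV stability UNCONDITIONAL — a real constructive-QFT result; it is NOT the continuum limit and NOT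
the Clay problem.»  HONEST DEPENDENCY (verbatim): «continuum YM on T⁴ ⇐ BetaPertH ∧ nine spine estimates (0/9 proved); BetaPertH ⇐ (D1) ∧ (D4) ∧ CAP+tail; G-an2-4 gates asym, D1
and NE2/3/4.»

## What is proved (generic `d`, `0 < n`, any `r`)
* §1 `abs_facePot_le` (`|G m| ≤ B·faceWtSum r n`), `facePot_blk_add_unitVec` (the block function of a single-coordinate weight moves only along its own direction).
* §2 **`tsum_coord_mul_faceWt_mul_faceSum`** (the face part: `Σ'_x s(x_α)·faceWt α x·faceSum n T (blk x) = Σ'_x (G((x_α+1)∕n) − G(x_α∕n))·T α x`) and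
  **`tsum_coord_mul_slotPsiS`** (the displayed identity); the class form **`tsum_class_mul_slotPsiS`** (`s = c + dΦ` ⟹ the new weight is `c + d(Φ + G(·∕n))`, bound
  `|Φ + G(·∕n)| ≤ B + (|c| + 2B)·faceWtSum`) and its packaging **`exists_classPot_slotPsiS`** (ONE new potential for ALL families `T` — the form the transport of a current needs).
* §3 the kernel-entry form `exists_classPot_slotPsiS_kernel` (stencil families, all passive legs; `slotPsiS_apply_kernel`).
WHAT THIS IS NOT: no statement about any particular table; NOT (D)_comb, NOT `hB0`; NEVER «G-an2-4 closed» as (CONV-C); NOT D1, NOT `BetaPertH`, NOT continuum, NOT Clay.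
2026-08-27; no existing file touched.
-/

noncomputable section

open Finset
open scoped BigOperators
open Literature.MathematicalPhysics.QuantumFieldTheory
open Literature.MathematicalPhysics.QuantumFieldTheory.Balaban1983to89
open Literature.MathematicalPhysics.QuantumFieldTheory.Balaban1983to89.Beta
open ExpKernelCalculus (Site MKer)
open OneStepResolventKernel (Fib)
open AffineAveraging (Form1 box toSite unitVec)
open AveragingContours (blk blk_block)
open KKTFluctuationEnergy (tsum_blocks summable_blocks)
open Summit.QuantumFields.BalabanUV.Beta.SymCorrectorFace (faceWt faceWtSum faceWtSum_nonneg abs_faceWt_le b6unitVec_eq faceSum slotPsiS slotPsiS_apply_kernel)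
open Summit.QuantumFields.BalabanUV.Beta.GAN24.SymCorrectorZeroMode (summable_faceSum summable_comp_blk faceWt_block faceSum_eq_sum_box_div summable_div)
open Summit.QuantumFields.BalabanUV.Beta.GAN24.SlotTransportPeriodicWeight (summable_weight_mul summable_weight_mul_faceWt_mul_faceSum)
open Summit.QuantumFields.BalabanUV.Beta.GAN24.CoarseGaugeSourceResponse (tsum_mul_coarseDiv_eq)

namespace Summit.QuantumFields.BalabanUV.Beta.GAN24.ClassWeightSlotTransport

variable {d : ℕ} {n : ℕ} (hn : 0 < n)
include hn

/-! ## §1 The block function of a single-coordinate weight -/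

omit hn in
/-- [folklore] **THE FACE POTENTIAL IS BOUNDED**: `|Σ_{b ∈ box} s(n·m + b_α)·faceWt α b| ≤ B·faceWtSum r n` for `|s| ≤ B`. -/
theorem abs_facePot_le (r : Fin (d + 1) → ℕ) {s : ℤ → ℝ} {B : ℝ} (hs : ∀ k, |s k| ≤ B) (α : Fin (d + 1)) (m : ℤ) :
    |∑ b ∈ box (d + 1) n, s ((n : ℤ) * m + toSite b α) * faceWt r n α (toSite b)| ≤ B * faceWtSum r n := by
  have hB : 0 ≤ B := (abs_nonneg _).trans (hs 0)
  calc |∑ b ∈ box (d + 1) n, s ((n : ℤ) * m + toSite b α) * faceWt r n α (toSite b)|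
      ≤ ∑ b ∈ box (d + 1) n, |s ((n : ℤ) * m + toSite b α) * faceWt r n α (toSite b)| := Finset.abs_sum_le_sum_abs _ _
    _ ≤ ∑ b ∈ box (d + 1) n, B * |faceWt r n α (toSite b)| := Finset.sum_le_sum fun b _ => by
        rw [abs_mul]; exact mul_le_mul_of_nonneg_right (hs _) (abs_nonneg _)
    _ = B * ∑ b ∈ box (d + 1) n, |faceWt r n α (toSite b)| := by rw [Finset.mul_sum]
    _ ≤ B * faceWtSum r n := mul_le_mul_of_nonneg_left
        (Finset.single_le_sum (f := fun α' => ∑ b ∈ box (d + 1) n, |faceWt r n α' (toSite b)|)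
          (fun _ _ => Finset.sum_nonneg fun _ _ => abs_nonneg _) (Finset.mem_univ α)) hB

omit hn in
/-- [folklore] **THE BLOCK FUNCTION OF A SINGLE-COORDINATE WEIGHT MOVES ONLY ALONG ITS OWN DIRECTION**: with `g(x) := Σ_b s(n·(x_α ∕ n) + b_α)·faceWt α b` (a function of the
`α`-th block coordinate of `x`), `g(x + e_κ) − g(x) = [κ = α]·(G((x_α+1) ∕ n) − G(x_α ∕ n))`. -/
theorem facePot_blk_add_unitVec (r : Fin (d + 1) → ℕ) (s : ℤ → ℝ) (α κ : Fin (d + 1)) (x : Site (d + 1)) :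
    (∑ b ∈ box (d + 1) n, s ((n : ℤ) * ((x + unitVec κ) α / (n : ℤ)) + toSite b α) * faceWt r n α (toSite b))
      - (∑ b ∈ box (d + 1) n, s ((n : ℤ) * (x α / (n : ℤ)) + toSite b α) * faceWt r n α (toSite b))
      = if κ = α then
          (∑ b ∈ box (d + 1) n, s ((n : ℤ) * ((x α + 1) / (n : ℤ)) + toSite b α) * faceWt r n α (toSite b))
            - (∑ b ∈ box (d + 1) n, s ((n : ℤ) * (x α / (n : ℤ)) + toSite b α) * faceWt r n α (toSite b))
        else 0 := by
  by_cases hκ : κ = α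
  · subst hκ
    simp only [if_true, Pi.add_apply, AffineAveraging.unitVec, Pi.single_eq_same]
  · rw [if_neg hκ]
    have hne : α ≠ κ := fun h => hκ h.symm
    have e : (x + unitVec κ) α = x α := by
      simp only [Pi.add_apply, AffineAveraging.unitVec, Pi.single_apply, if_neg hne, add_zero]
    rw [e, sub_self]

/-! ## §2 The weighted slot sum through the slot transport -/

/-- [folklore] **THE FACE PART OF A SINGLE-COORDINATE-WEIGHTED SLOT SUM**: for a bond family `T` with summable components, bounded `s`, slot direction `α`,
`Σ'_x s(x_α)·faceWt α x·faceSum n T (blk x) = Σ'_x (G((x_α+1)∕n) − G(x_α∕n))·T α x`, `G(m) = Σ_b s(n·m + b_α)·faceWt α b` — cell decomposition, the face sum as the block total of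
the divergence (TT7), summation by parts on `ℤ^{d+1}` (road-P2's `tsum_mul_coarseDiv_eq`), and §1. -/
theorem tsum_coord_mul_faceWt_mul_faceSum (r : Fin (d + 1) → ℕ) {T : Form1 (d + 1) ℝ} (hT : ∀ κ, Summable (T κ)) {s : ℤ → ℝ} {B : ℝ} (hs : ∀ k, |s k| ≤ B)
    (α : Fin (d + 1)) :
    ∑' x, s (x α) * faceWt r n α x * faceSum n T (blk n x)
      = ∑' x, ((∑ b ∈ box (d + 1) n, s ((n : ℤ) * ((x α + 1) / (n : ℤ)) + toSite b α) * faceWt r n α (toSite b))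
          - (∑ b ∈ box (d + 1) n, s ((n : ℤ) * (x α / (n : ℤ)) + toSite b α) * faceWt r n α (toSite b))) * T α x := by
  classical
  haveI : NeZero n := ⟨hn.ne'⟩
  have hB : 0 ≤ B := (abs_nonneg _).trans (hs 0)
  -- the block function `g(Y) := Σ_b s(n·Y_α + b_α)·faceWt α b` and its lattice pull-back
  set g : Site (d + 1) → ℝ := fun Y => ∑ b ∈ box (d + 1) n, s ((n : ℤ) * Y α + toSite b α) * faceWt r n α (toSite b) with hg
  have hgb : ∀ Y, |g Y| ≤ B * faceWtSum r n := fun Y => abs_facePot_le r hs α (Y α)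
  have hgblk : ∀ x : Site (d + 1), g (blk n x) = ∑ b ∈ box (d + 1) n, s ((n : ℤ) * (x α / (n : ℤ)) + toSite b α) * faceWt r n α (toSite b) := fun x => by
    simp only [hg, AveragingContours.blk]
  -- (1) cell decomposition: the weighted face family, block by block
  have hF := summable_weight_mul_faceWt_mul_faceSum hn r hT (ω := fun x => s (x α)) (fun x => hs (x α)) α
  have step1 : ∑' x, s (x α) * faceWt r n α x * faceSum n T (blk n x) = ∑' Y, g Y * faceSum n T Y := by
    rw [BiStencilZeroMode.tsum_eq_sum_box_tsum (N := n) hF]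
    have e : ∀ (b : Fin (d + 1) → ℕ), b ∈ box (d + 1) n → ∀ t : Site (d + 1),
        s (((n : ℤ) • t + toSite b) α) * faceWt r n α ((n : ℤ) • t + toSite b) * faceSum n T (blk n ((n : ℤ) • t + toSite b))
          = (s ((n : ℤ) * t α + toSite b α) * faceWt r n α (toSite b)) * faceSum n T t := by
      intro b hb t
      rw [faceWt_block hn, blk_block _ hb]
      simp only [Pi.add_apply, Pi.smul_apply, smul_eq_mul]
    rw [Finset.sum_congr rfl fun b hb => tsum_congr fun t => e b hb t]
    have hsum : ∀ b ∈ box (d + 1) n, Summable fun t : Site (d + 1) => (s ((n : ℤ) * t α + toSite b α) * faceWt r n α (toSite b)) * faceSum n T t := by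
      intro b _
      refine summable_weight_mul (B := B * |faceWt r n α (toSite b)|) (fun t => ?_) (summable_faceSum hn hT)
      rw [abs_mul]; exact mul_le_mul_of_nonneg_right (hs _) (abs_nonneg _)
    rw [← Summable.tsum_finsetSum hsum]
    refine tsum_congr fun t => ?_
    rw [← Finset.sum_mul]
  -- (2) the face sum is the block total of the divergence; undo the block regrouping
  have hdivS : Summable fun x : Site (d + 1) => g (blk n x) * ∑ κ : Fin (d + 1), (T κ (x - unitVec κ) - T κ x) :=
    summable_weight_mul (fun x => hgb (blk n x)) (summable_div hT)
  have step2 : ∑' Y, g Y * faceSum n T Y = ∑' x, g (blk n x) * ∑ κ : Fin (d + 1), (T κ (x - unitVec κ) - T κ x) := by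
    rw [tsum_blocks (N := n) hdivS]
    refine tsum_congr fun Y => ?_
    rw [faceSum_eq_sum_box_div hn T Y, Finset.mul_sum]
    refine Finset.sum_congr rfl fun b hb => ?_
    rw [blk_block _ hb]
  -- (3) summation by parts
  have step3 : ∑' x, g (blk n x) * ∑ κ : Fin (d + 1), (T κ (x - unitVec κ) - T κ x)
      = ∑ κ : Fin (d + 1), ∑' x, (g (blk n (x + unitVec κ)) - g (blk n x)) * T κ x := by
    have h := tsum_mul_coarseDiv_eq (d := d) T hT (fun x => g (blk n x)) (fun x => hgb (blk n x))
    simp only [b6unitVec_eq] at h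
    exact h
  -- (4) only the direction `κ = α` survives
  have step4 : ∀ κ : Fin (d + 1), ∑' x, (g (blk n (x + unitVec κ)) - g (blk n x)) * T κ x
      = if κ = α then ∑' x, ((∑ b ∈ box (d + 1) n, s ((n : ℤ) * ((x α + 1) / (n : ℤ)) + toSite b α) * faceWt r n α (toSite b))
          - (∑ b ∈ box (d + 1) n, s ((n : ℤ) * (x α / (n : ℤ)) + toSite b α) * faceWt r n α (toSite b))) * T α x else 0 := by
    intro κ
    have e : ∀ x : Site (d + 1), (g (blk n (x + unitVec κ)) - g (blk n x)) * T κ x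
        = (if κ = α then
            (∑ b ∈ box (d + 1) n, s ((n : ℤ) * ((x α + 1) / (n : ℤ)) + toSite b α) * faceWt r n α (toSite b))
              - (∑ b ∈ box (d + 1) n, s ((n : ℤ) * (x α / (n : ℤ)) + toSite b α) * faceWt r n α (toSite b))
          else 0) * T κ x := fun x => by rw [hgblk, hgblk, facePot_blk_add_unitVec r s α κ x]
    rw [tsum_congr e]
    split_ifs with hκ
    · subst hκ; rfl
    · simp only [zero_mul, tsum_zero]
  rw [step1, step2, step3, Finset.sum_congr rfl fun κ _ => step4 κ, Finset.sum_ite_eq' Finset.univ α, if_pos (Finset.mem_univ _)]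

/-- NOT IN PRINT; OUR BOOKKEEPING ([folklore]).  **A SINGLE-COORDINATE-WEIGHTED SLOT SUM SEES THE SLOT TRANSPORT AS A SINGLE-COORDINATE REWEIGHTING OF THE SAME DIRECTION**:
for a bond family `T` with summable components, bounded `s : ℤ → ℝ` and a slot direction `α`,
`Σ'_x s(x_α)·slotPsiS r n T α x = Σ'_x (s(x_α) + (G((x_α+1)∕n) − G(x_α∕n)))·T α x`, `G(m) = Σ_{b ∈ box} s(n·m + b_α)·faceWt r n α b`. -/
theorem tsum_coord_mul_slotPsiS (r : Fin (d + 1) → ℕ) {T : Form1 (d + 1) ℝ} (hT : ∀ κ, Summable (T κ)) {s : ℤ → ℝ} {B : ℝ} (hs : ∀ k, |s k| ≤ B) (α : Fin (d + 1)) :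
    ∑' x, s (x α) * slotPsiS r n T α x
      = ∑' x, (s (x α) + ((∑ b ∈ box (d + 1) n, s ((n : ℤ) * ((x α + 1) / (n : ℤ)) + toSite b α) * faceWt r n α (toSite b))
          - (∑ b ∈ box (d + 1) n, s ((n : ℤ) * (x α / (n : ℤ)) + toSite b α) * faceWt r n α (toSite b)))) * T α x := by
  have e : ∀ x, s (x α) * slotPsiS r n T α x = s (x α) * T α x + s (x α) * faceWt r n α x * faceSum n T (blk n x) := fun x => by
    show s (x α) * (T α x + faceWt r n α x • faceSum n T (blk n x)) = _
    rw [smul_eq_mul]; ring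
  have hF := summable_weight_mul_faceWt_mul_faceSum hn r hT (ω := fun x => s (x α)) (fun x => hs (x α)) α
  have hpot : ∀ x : Site (d + 1), |(∑ b ∈ box (d + 1) n, s ((n : ℤ) * ((x α + 1) / (n : ℤ)) + toSite b α) * faceWt r n α (toSite b))
      - (∑ b ∈ box (d + 1) n, s ((n : ℤ) * (x α / (n : ℤ)) + toSite b α) * faceWt r n α (toSite b))| ≤ B * faceWtSum r n + B * faceWtSum r n := fun x =>
    (abs_sub _ _).trans (add_le_add (abs_facePot_le r hs α _) (abs_facePot_le r hs α _))
  have e2 : ∀ x, (s (x α) + ((∑ b ∈ box (d + 1) n, s ((n : ℤ) * ((x α + 1) / (n : ℤ)) + toSite b α) * faceWt r n α (toSite b))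
          - (∑ b ∈ box (d + 1) n, s ((n : ℤ) * (x α / (n : ℤ)) + toSite b α) * faceWt r n α (toSite b)))) * T α x
      = s (x α) * T α x + ((∑ b ∈ box (d + 1) n, s ((n : ℤ) * ((x α + 1) / (n : ℤ)) + toSite b α) * faceWt r n α (toSite b))
          - (∑ b ∈ box (d + 1) n, s ((n : ℤ) * (x α / (n : ℤ)) + toSite b α) * faceWt r n α (toSite b))) * T α x := fun x => by ring
  rw [tsum_congr e, (summable_weight_mul (fun x => hs (x α)) (hT α)).tsum_add hF, tsum_coord_mul_faceWt_mul_faceSum hn r hT hs α, tsum_congr e2,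
    (summable_weight_mul (fun x => hs (x α)) (hT α)).tsum_add (summable_weight_mul hpot (hT α))]

/-! ## §2b The class form: `c + dΦ` stays `c + dΦ′`, ONE potential for all families -/

/-- NOT IN PRINT; OUR BOOKKEEPING ([folklore]).  **THE CLASS «constant + lattice gradient of a bounded single-coordinate function» IS STABLE UNDER THE SLOT TRANSPORT**:
for `s(k) = c + (Φ(k+1) − Φ(k))`, `|Φ| ≤ B`, the transported weight is `c + (Φ′(k+1) − Φ′(k))` with
`Φ′(k) = Φ(k) + Σ_{b ∈ box} (c + (Φ(n·(k∕n) + b_α + 1) − Φ(n·(k∕n) + b_α)))·faceWt r n α b` — explicitly. -/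
theorem tsum_class_mul_slotPsiS (r : Fin (d + 1) → ℕ) {T : Form1 (d + 1) ℝ} (hT : ∀ κ, Summable (T κ)) (c : ℝ) (Φ : ℤ → ℝ) {B : ℝ} (hΦ : ∀ k, |Φ k| ≤ B)
    (α : Fin (d + 1)) :
    ∑' x, (c + (Φ (x α + 1) - Φ (x α))) * slotPsiS r n T α x
      = ∑' x, (c + ((Φ (x α + 1) + ∑ b ∈ box (d + 1) n, (c + (Φ ((n : ℤ) * ((x α + 1) / (n : ℤ)) + toSite b α + 1) - Φ ((n : ℤ) * ((x α + 1) / (n : ℤ)) + toSite b α))) * faceWt r n α (toSite b))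
          - (Φ (x α) + ∑ b ∈ box (d + 1) n, (c + (Φ ((n : ℤ) * (x α / (n : ℤ)) + toSite b α + 1) - Φ ((n : ℤ) * (x α / (n : ℤ)) + toSite b α))) * faceWt r n α (toSite b)))) * T α x := by
  have hs : ∀ k : ℤ, |c + (Φ (k + 1) - Φ k)| ≤ |c| + (B + B) := fun k =>
    (abs_add_le _ _).trans (add_le_add le_rfl ((abs_sub _ _).trans (add_le_add (hΦ _) (hΦ _))))
  rw [tsum_coord_mul_slotPsiS hn r hT (s := fun k => c + (Φ (k + 1) - Φ k)) hs α]
  exact tsum_congr fun x => by ring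

/-- NOT IN PRINT; OUR BOOKKEEPING ([folklore]; THE FORM THE TRANSPORT OF A CURRENT NEEDS).  For every `c`, bounded `Φ` and slot direction `α` there is ONE bounded potential `Φ′`
(`|Φ′| ≤ B + (|c| + 2B)·faceWtSum r n`) such that FOR EVERY bond family `T` with summable components
`Σ'_x (c + (Φ(x_α+1) − Φ(x_α)))·slotPsiS r n T α x = Σ'_x (c + (Φ′(x_α+1) − Φ′(x_α)))·T α x`. -/
theorem exists_classPot_slotPsiS (r : Fin (d + 1) → ℕ) (c : ℝ) (Φ : ℤ → ℝ) {B : ℝ} (hΦ : ∀ k, |Φ k| ≤ B) (α : Fin (d + 1)) :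
    ∃ Φ' : ℤ → ℝ, (∀ k, |Φ' k| ≤ B + (|c| + (B + B)) * faceWtSum r n) ∧
      ∀ (T : Form1 (d + 1) ℝ), (∀ κ, Summable (T κ)) →
        ∑' x, (c + (Φ (x α + 1) - Φ (x α))) * slotPsiS r n T α x = ∑' x, (c + (Φ' (x α + 1) - Φ' (x α))) * T α x := by
  have hs : ∀ k : ℤ, |c + (Φ (k + 1) - Φ k)| ≤ |c| + (B + B) := fun k =>
    (abs_add_le _ _).trans (add_le_add le_rfl ((abs_sub _ _).trans (add_le_add (hΦ _) (hΦ _))))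
  refine ⟨fun k => Φ k + ∑ b ∈ box (d + 1) n, (c + (Φ ((n : ℤ) * (k / (n : ℤ)) + toSite b α + 1) - Φ ((n : ℤ) * (k / (n : ℤ)) + toSite b α))) * faceWt r n α (toSite b),
    fun k => ?_, fun T hT => tsum_class_mul_slotPsiS hn r hT c Φ hΦ α⟩
  refine (abs_add_le _ _).trans (add_le_add (hΦ k) ?_)
  have h := abs_facePot_le (n := n) r (s := fun k => c + (Φ (k + 1) - Φ k)) hs α (k / (n : ℤ))
  refine le_trans (le_of_eq ?_) h
  congr 1

/-! ## §3 The kernel-entry form (stencil families) -/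

/-- NOT IN PRINT; OUR BOOKKEEPING ([folklore]; ENTRYWISE, FOR STENCIL FAMILIES — ONE potential for all families AND all passive indices).  For every `c`, bounded `Φ` and slot
direction `α` there is ONE bounded `Φ′` such that for every stencil family `S` and all legs `p q a b` with summable slot entries
`Σ'_x (c + (Φ(x_α+1) − Φ(x_α)))·slotPsiS r n S α x p q a b = Σ'_x (c + (Φ′(x_α+1) − Φ′(x_α)))·S α x p q a b` (`slotPsiS_apply_kernel` ⨾ §2b). -/
theorem exists_classPot_slotPsiS_kernel (r : Fin (d + 1) → ℕ) (c : ℝ) (Φ : ℤ → ℝ) {B : ℝ} (hΦ : ∀ k, |Φ k| ≤ B) (α : Fin (d + 1)) :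
    ∃ Φ' : ℤ → ℝ, (∀ k, |Φ' k| ≤ B + (|c| + (B + B)) * faceWtSum r n) ∧
      ∀ (S : Fin (d + 1) → Site (d + 1) → MKer (d + 1) (Fib d)) (p q : Site (d + 1)) (a b : Fib d), (∀ κ, Summable fun x => S κ x p q a b) →
        ∑' x, (c + (Φ (x α + 1) - Φ (x α))) * slotPsiS r n S α x p q a b = ∑' x, (c + (Φ' (x α + 1) - Φ' (x α))) * S α x p q a b := by
  obtain ⟨Φ', hb, hT⟩ := exists_classPot_slotPsiS hn r c Φ hΦ α
  refine ⟨Φ', hb, fun S p q a b hS => ?_⟩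
  have e : ∀ x, slotPsiS r n S α x p q a b = slotPsiS r n (fun κ u => S κ u p q a b) α x := fun x => slotPsiS_apply_kernel r n S α x p q a b
  simp only [e]
  exact hT (fun κ u => S κ u p q a b) hS

end Summit.QuantumFields.BalabanUV.Beta.GAN24.ClassWeightSlotTransport

end
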